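import Summits.HodgeConjecture.HodgeConjecture.Theorems.VHCAbelianSchemesRoadSecantQuotientAnchorCMBridge
import Summits.HodgeConjecture.HodgeConjecture.Theorems.Ring2AbelianAllEllipticTensorWeilCarriersDefs
import Literature.AlgebraicGeometry.HodgeTheory.WeilClassesOfIsogenyTransportOfStructure
import Literature.AlgebraicGeometry.HodgeTheory.WeilTypeIsogenyClassSquares
import HarnessLib

/-!
# Road b02 (`VHCAbelianSchemesRoad`, D-0059) — lane W1 of crux `SemiregularSheafRepresentativesTwAtDiag` (item stmt-HodgeConjecture-19787),
# stub 2a″: THE SERVED CLASSES ARE `E`-WEIL CLASSES OF A STRUCTURE ON THE ANCHOR ITSELF (the descended operator `ψ_Y = r φ_d q` on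
# `Y = (J × Ĵ)/Ḡ`), hence the SHARPER bound «2a″ ⟸ carriers for imaginary-quadratic Weil classes on polarised abelian sixfolds», and at the
# `E³`-type special fibres «2a″ ⟸ `EllipticTensorWeilCarriers 𝒪 E₀`» — the smallest ∀-node of the André column covering them (fact-free)

research route conditional on HC_CM; not a corollary; Q11.4-sentence-2 already refuted in dim ≥ 3.

THEOREMS ONLY (no definition, no named fact, no claim-tagged fact imported; `HC_CM` nowhere). Sequel of
`VHCAbelianSchemesRoadSecantQuotientAnchorCMBridge` (p528000: `E³`-type ∕ CM secant–quotient anchors are André-column anchors; 2a″ there ⟸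
`EllipticPowerAlgebraic(Twisted)Carriers`; cell's served half; spreading). That file served the `E³`-type anchors from the node «carriers for ALL
ALGEBRAIC classes on elliptic powers». Here the currency is sharpened to WEIL CLASSES:

* §1 `SecantQuotientDatum.exists_descended_weilStructure` — on `Y = (J × Ĵ)/Ḡ` there is `ψ_Y` (`:= r ≫ φ_d ≫ q`, `r` a quasi-inverse of the
  quotient isogeny, `q ≫ r = [d+1]`) with `ψ_Y² = −(d+1)²d` and `q^*b ∈ W(J × Ĵ, φ_d, 3, d) ↔ b ∈ W(Y, ψ_Y, 3, (d+1)²d)` (van Geemen 3.6 in the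
  tree's form `map_mem_weilClassesOf_iff_of_comp_eq_nsmul_comp`; Markman §1.5: «the `K`-action … carried to `Y` through `q`»).
* §2 Hence every (pinned-)served class `γ` at an anchor `(X, θ)` lies in the André column's served set `weilStructureServedClasses 6 3 X θ`
  (`Ring2AbelianAllEllipticTensorWeilCarriersDefs`, p520421): it is a rational `(3,3)` `E`-Weil class of the imaginary-quadratic structure
  `(Y, ψ_Y)` read through the chart — not merely algebraic-Lefschetz (ring2-b02 g90, p523449).
* §3 UPPER BOUNDS BY NAME, sharper than p523449's «Lefschetz directions» and than p528000's «algebraic classes»: 2a″ (door-generic body, and the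
  stub per `C`) ⟸ `AnchoredCarrierAt 𝒪 6 3 (polarised) (weilStructureServedClasses 6 3)` («Weil carriers on polarised abelian sixfolds»); 2a″
  restricted to the pinned anchors in any `𝔄₀` ⟸ the same at the polarised members of `𝔄₀`; and at the `E³`-TYPE anchors over a fixed `E₀`
  (charts of data with `J ∼ E₀³`, so `Y ∼ E₀⁶`) ⟸ **`EllipticTensorWeilCarriers 𝒪 E₀`** (twisted: `EllipticTensorWeilTwistedCarriers E₀`), with
  the per-datum chart form, the cell's served half on the pencils through such a fibre, and the spreading of algebraicity to every fibre of such
  a pencil (PART AA-e) modulo the door.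

HONEST LIMITS. As in the Bridge file: no carrier is constructed (the nodes are OPEN hypotheses by name; nothing here says any of them, 2a″, a
cell, K-SR♭∃, VHC, `HC_AV`, `HC_CM` or HC holds); gap (G3) untouched (the node is a per-class ∀-statement); non-emptiness of the `E³`-type
anchors not proved; (c1)∕(c2) of p523449 stand. What §2 adds to the census words: the road's 2a″ is, anchor by anchor, a statement of the SAME
SHAPE as the column's Weil-carrier nodes (`OneHyperbolicWeilCarrier`, `TensorWeilCarriers`, `EllipticTensorWeilCarriers`): a door datum for a
rational Weil class of an imaginary-quadratic structure `(A₀, ψ₀)` on a polarised abelian sixfold, modulo the `θ`-ray.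

References: [cite: Markman2025SecantWeil, §1.5 (p. 7), §3.2, Thm. 1.4.1 and Thm. 1.5.1] [cite: vanGeemen1994HodgeAV, 3.6 (p. 236), 4.9 and Lemma 5.2]
[cite: Andre1996Motifs, Lemme 6.3.3 and proof (p. 33)] [cite: MumfordAV1970, §19 (Remark p. 169)] [cite: MilneAV2008, I §8 Rem. 8.6 and 8.12]
[cite: Bloch1972Semiregularity, Remark (7.5)] [cite: BuchweitzFlenner2003, §5 Thm. 5.1].
-/

noncomputable section

open CategoryTheory CategoryTheory.Limits AlgebraicGeometry Topology

namespace Summit.HodgeConjecture.HodgeConjecture.Ring2.SemiregularRepresentatives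

set_option linter.dupNamespace false -- the cell's namespace repeats the summit name, as in every `Ring2*` file

open Literature.AlgebraicGeometry Literature.AlgebraicGeometry.Motives Literature.AlgebraicGeometry.Motives.AbelianVariety
open Literature.AlgebraicGeometry.HodgeTheory Literature.AlgebraicGeometry.Markman2025
open Literature.AlgebraicTopology.SingularHomology
open Summit.Ventures.HSemireg (ObjClass LocalVariationalHodgeFor)

section WeilStructure

open Summit.HodgeConjecture.HodgeConjecture.Ring2.AbelianAll (weilStructureServedClasses ellipticPowerPolarisedAnchorOf
  EllipticTensorWeilCarriers EllipticTensorWeilTwistedCarriers)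

/-! ## §1 The descended Weil structure `ψ_Y` on `Y = (J × Ĵ)/Ḡ` -/

namespace SecantQuotientDatum

variable (D : SecantQuotientDatum)

/-- `φ_d ≫ φ_d = -(d • 𝟙)` with a NATURAL-number scalar (the datum API states it with `(d : ℤ) •`). [cite: Markman2025SecantWeil, §3.2] -/
theorem ψ_comp_ψ_nsmul : D.ψ ≫ D.ψ = -(D.d • 𝟙 D.P) := by
  rw [D.ψ_comp_ψ, natCast_zsmul]

/-- **A quasi-inverse of the quotient isogeny**: `∃ r : Y → J × Ĵ` with `q ≫ r = [d+1]` (F4 `exists_secantQuotientMap_comp_eq_zsmul_id`,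
restated on the datum's names with a natural-number scalar). [cite: MilneAV2008, I §8 Rem. 8.6 and Rem. 8.12 (pp. 36–39)] -/
theorem exists_q_comp_eq_nsmul_id : ∃ r : D.Y ⟶ D.P, D.q ≫ r = (D.d + 1) • 𝟙 D.P := by
  obtain ⟨r, hr⟩ := exists_secantQuotientMap_comp_eq_zsmul_id D.𝒥.J D.isAmple D.G₁ D.G₂ D.succ_ne_zero D.G₁_le D.G₂_le
  have h : D.q ≫ r = ((D.d + 1 : ℕ) : ℤ) • 𝟙 D.P := hr
  exact ⟨r, h.trans (natCast_zsmul _ _)⟩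

/-- **THE DESCENDED WEIL STRUCTURE ON `Y = (J × Ĵ)/Ḡ`**: there is `ψ_Y : Y → Y` with `ψ_Y ≫ ψ_Y = -((d+1)²·d) • 𝟙_Y` whose Weil plane in
degree `6` is EXACTLY the descent of that of `(J × Ĵ, φ_d)`: `q^*b ∈ W(J × Ĵ, φ_d, 3, d) ↔ b ∈ W(Y, ψ_Y, 3, (d+1)²d)` for every `b ∈ H⁶(Y)`.
Construction: `ψ_Y := r ≫ φ_d ≫ q` for a quasi-inverse `r` of the quotient isogeny (`q ≫ r = [d+1]`); the square by `conj_comp_conj`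
(`r ≫ q = [d+1]` too, `q` being an epimorphism among homomorphisms), the Weil planes by van Geemen 3.6 in the tree's form
`map_mem_weilClassesOf_iff_of_comp_eq_nsmul_comp` (`q` intertwines `(d+1)·φ_d` and `ψ_Y`, `comp_conj_eq_nsmul_comp`). Markman: «the
`K`-action … carried to `Y` through `q`» (§1.5 p. 7). [cite: Markman2025SecantWeil, §1.5 (p. 7) and §3.2]
[cite: vanGeemen1994HodgeAV, 3.6 (p. 236) and proof of Lemma 5.2] [cite: MumfordAV1970, §19 (Remark p. 169)] -/
theorem exists_descended_weilStructure :
    ∃ ψY : D.Y ⟶ D.Y, ψY ≫ ψY = -(((D.d + 1) ^ 2 * D.d) • 𝟙 D.Y) ∧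
      ∀ b : complexBetti D.Y.X (2 * 3),
        complexBetti.map D.q.hom.hom.hom (2 * 3) b ∈ weilClassesOf D.P D.ψ 3 D.d ↔ b ∈ weilClassesOf D.Y ψY 3 ((D.d + 1) ^ 2 * D.d) := by
  obtain ⟨r, hr⟩ := D.exists_q_comp_eq_nsmul_id
  -- `r ≫ q = [d+1]` on `Y`: cancel the epimorphism `q` on the left
  have hrq : r ≫ D.q = (D.d + 1) • 𝟙 D.Y := by
    apply D.isIsogeny_q.cancel_left
    rw [← Category.assoc, hr, Preadditive.nsmul_comp, Category.id_comp, Preadditive.comp_nsmul, Category.comp_id]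
  refine ⟨r ≫ D.ψ ≫ D.q, conj_comp_conj D.q r hr hrq D.ψ_comp_ψ_nsmul, fun b ↦ ?_⟩
  have hd : 0 < D.d := by have := D.four_le; omega
  exact map_mem_weilClassesOf_iff_of_comp_eq_nsmul_comp D.isIsogeny_q (comp_conj_eq_nsmul_comp D.q r hr D.ψ) D.ψ_comp_ψ_nsmul
    hd (Nat.succ_pos D.d)

end SecantQuotientDatum

/-! ## §2 Served classes are `E`-Weil classes of a structure on the anchor -/

variable {X : SchemeOver ℂ} {θ : complexBetti X 2} {γ : complexBetti X (2 * 3)}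

/-- **A served class is an `E`-WEIL CLASS OF AN IMAGINARY-QUADRATIC STRUCTURE ON THE ANCHOR ITSELF** (v3 data): a class `γ` with
`IsSecantQuotientWeilClassAt X θ γ` lies in the André column's served set `weilStructureServedClasses 6 3 X θ` — witness the abelian sixfold
`Y`, the chart, the descended operator `ψ_Y` (`ψ_Y² = -((d+1)²d)`) and `δ = (d+1)²·d`. So at the secant–quotient anchors the road's served classes
are not merely algebraic-Lefschetz (p523449) but WEIL classes of a `ℚ(√−d)`-structure on the anchor, the currency of the column's Weil-carrier
nodes. [cite: Markman2025SecantWeil, §1.5 (p. 7), §3.2 and Thm. 1.4.1] [cite: vanGeemen1994HodgeAV, 3.6, 4.9 and Lemma 5.2] -/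
theorem IsSecantQuotientWeilClassAt.mem_weilStructureServedClasses (h : IsSecantQuotientWeilClassAt X θ γ) :
    γ ∈ weilStructureServedClasses 6 3 X θ := by
  have hH := h.isOfHodgeType
  obtain ⟨D, e, -, -, -, -, -, hmem⟩ := h
  obtain ⟨ψY, hsq, hiff⟩ := D.exists_descended_weilStructure
  refine ⟨hH, D.Y, e.symm, ψY, Or.inl ⟨(D.d + 1) ^ 2 * D.d, ?_, hsq, rfl, ?_⟩⟩
  · exact Nat.mul_pos (pow_pos (Nat.succ_pos D.d) 2) (by have := D.four_le; omega)
  · exact (hiff _).1 hmem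

/-- The pinned form. [cite: Markman2025SecantWeil, §1.5 (p. 7), §3.2 and Thm. 1.4.1] [cite: vanGeemen1994HodgeAV, 3.6 and Lemma 5.2] -/
theorem IsSecantQuotientWeilClassAtPinned.mem_weilStructureServedClasses (h : IsSecantQuotientWeilClassAtPinned X θ γ) :
    γ ∈ weilStructureServedClasses 6 3 X θ :=
  h.toAt.mem_weilStructureServedClasses

/-- `𝔖^pin X θ ⊆ weilStructureServedClasses 6 3 X θ`. [cite: Markman2025SecantWeil, Thm. 1.4.1] [cite: vanGeemen1994HodgeAV, 4.9] -/
theorem secantQuotientServedClassesPinned_subset_weilStructureServedClasses (X : SchemeOver ℂ) (θ : complexBetti X 2) :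
    secantQuotientServedClassesPinned X θ ⊆ weilStructureServedClasses 6 3 X θ :=
  fun _ hγ ↦ IsSecantQuotientWeilClassAtPinned.mem_weilStructureServedClasses hγ

/-- `𝔖 X θ ⊆ weilStructureServedClasses 6 3 X θ` (v3). [cite: Markman2025SecantWeil, Thm. 1.4.1] [cite: vanGeemen1994HodgeAV, 4.9] -/
theorem secantQuotientServedClasses_subset_weilStructureServedClasses (X : SchemeOver ℂ) (θ : complexBetti X 2) :
    secantQuotientServedClasses X θ ⊆ weilStructureServedClasses 6 3 X θ :=
  fun _ hγ ↦ IsSecantQuotientWeilClassAt.mem_weilStructureServedClasses hγ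

/-! ## §3 Upper bounds by name: Weil carriers; the `E³`-type anchors from `EllipticTensorWeilCarriers 𝒪 E₀` -/

variable {𝒪 : ObjClass}

/-- **2a″ RESTRICTED TO THE PINNED ANCHORS IN `𝔄₀` ⟸ CARRIERS FOR IMAGINARY-QUADRATIC WEIL CLASSES AT THE POLARISED MEMBERS OF `𝔄₀`** — the
SHARPER upper bound by name (Weil classes of a structure on the anchor, a `2`-dimensional space per structure, instead of all algebraic ∕ all
Lefschetz classes). Door-generic. [cite: Bloch1972Semiregularity, Remark (7.5)] [cite: Markman2025SecantWeil, Thm. 1.4.1 and §1.5]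
[cite: vanGeemen1994HodgeAV, 4.9 and Lemma 5.2] -/
theorem anchoredCarrierAt_secantQuotientPinned_and_of_polarised_weil {𝔄₀ : SchemeOver ℂ → Prop}
    (h : AnchoredCarrierAt 𝒪 6 3 (fun X θ ↦ 𝔄₀ X ∧ IsPolarizationClass 6 X θ) (weilStructureServedClasses 6 3)) :
    AnchoredCarrierAt 𝒪 6 3 (fun X θ ↦ secantQuotientAnchorsPinned X θ ∧ 𝔄₀ X) (fun X θ ↦ secantQuotientServedClassesPinned X θ) :=
  anchoredCarrierAt_anti (𝔄' := fun X θ ↦ 𝔄₀ X ∧ IsPolarizationClass 6 X θ)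
    (fun _ _ hXθ ↦ by obtain ⟨⟨γ, hγ⟩, h₀⟩ := hXθ; exact ⟨h₀, hγ.isPolarizationClass⟩)
    (fun X θ _ ↦ secantQuotientServedClassesPinned_subset_weilStructureServedClasses X θ) h

/-- **2a″ ITSELF ⟸ «WEIL CARRIERS ON POLARISED ABELIAN SIXFOLDS»**: if at every complex scheme with a polarisation class `θ` every RATIONAL
`E`-Weil class of an imaginary-quadratic (or CM-field) structure on it is served by an `𝒪`-datum modulo the `θ`-ray, then
`AnchoredCarrierAt 𝒪 6 3 𝔄^pin 𝔖^pin` (the door-generic body of `SecantQuotientAnchorCarrier63Pinned`). Sharpens ring2-b02 g90's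
`secantQuotientAnchorCarrier63Pinned_of_lefschetzDirections` (Weil ⊂ Lefschetz at these anchors). Nothing says the hypothesis holds.
[cite: Markman2025SecantWeil, Thm. 1.4.1 and §1.5] [cite: vanGeemen1994HodgeAV, 4.9] [cite: Bloch1972Semiregularity, Remark (7.5)] -/
theorem anchoredCarrierAt_secantQuotientPinned_of_weilCarriers
    (h : AnchoredCarrierAt 𝒪 6 3 (fun X θ ↦ IsPolarizationClass 6 X θ) (weilStructureServedClasses 6 3)) :
    AnchoredCarrierAt 𝒪 6 3 (fun X θ ↦ secantQuotientAnchorsPinned X θ) (fun X θ ↦ secantQuotientServedClassesPinned X θ) :=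
  anchoredCarrierAt_anti (𝔄' := fun X θ ↦ IsPolarizationClass 6 X θ)
    (fun _ _ hXθ ↦ by obtain ⟨γ, hγ⟩ := hXθ; exact hγ.isPolarizationClass)
    (fun X θ _ ↦ secantQuotientServedClassesPinned_subset_weilStructureServedClasses X θ) h

/-- **Twisted door: the stub `stub_anchorCarrier_63_secantQuotientPinned` ⟸ Weil carriers on polarised abelian sixfolds, per `C`.**
[cite: Markman2025SecantWeil, Thm. 1.4.1, §1.5 and §7.3] [cite: Bloch1972Semiregularity, Remark (7.5)] -/
theorem secantQuotientAnchorCarrier63Pinned_of_weilCarriers {C : ChernCharacterBetti}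
    (h : AnchoredCarrierAt (Literature.AlgebraicGeometry.HodgeTheory.twistedReflexiveClass C
        (fun n X₀ I E => Summit.Ventures.HSemireg.gluableSigmaAdmissible n X₀ I E ∨
          Literature.AlgebraicGeometry.HodgeTheory.bfSingleAdmissible n X₀ I E)) 6 3
      (fun X θ ↦ IsPolarizationClass 6 X θ) (weilStructureServedClasses 6 3)) :
    SecantQuotientAnchorCarrier63Pinned C :=
  anchoredCarrierAt_secantQuotientPinned_of_weilCarriers h

/-- **2a″ AT THE `E³`-TYPE ANCHORS OVER A FIXED ELLIPTIC CURVE `E₀` ⟸ THE COLUMN'S NODE `EllipticTensorWeilCarriers 𝒪 E₀`** (carriers for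
`E`-Weil classes on powers of ONE elliptic curve; at `(6,3)`): on the pinned anchors `X ≅ A₀ ∼ E₀^{N+1}` every pinned-served class is a rational
`E`-Weil class of the descended structure, so the node serves it. The smallest ∀-node of the §AbelianAll table that covers the `E³`-type special
fibres. [cite: Andre1996Motifs, Lemme 6.3.3 and proof (p. 33)] [cite: Markman2025SecantWeil, §1.5 and Thm. 1.4.1] [cite: Bloch1972Semiregularity, Remark (7.5)] -/
theorem anchoredCarrierAt_secantQuotientPinned_ellipticPowerOf_of_ellipticTensorWeilCarriers {E₀ : AbelianVariety ℂ}
    (h : EllipticTensorWeilCarriers 𝒪 E₀) :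
    AnchoredCarrierAt 𝒪 6 3
      (fun X θ ↦ secantQuotientAnchorsPinned X θ ∧
        ∃ (A₀ : AbelianVariety ℂ) (N : ℕ), A₀.dim = 6 ∧ A₀.IsIsogenous (E₀.powSucc N) ∧ Nonempty (A₀.X ≅ X))
      (fun X θ ↦ secantQuotientServedClassesPinned X θ) :=
  anchoredCarrierAt_secantQuotientPinned_and_of_polarised_weil (h 6 3 (by norm_num) (by norm_num))

/-- **Per datum**: for a datum with `J ∼ E₀³`, on every chart `X ≅ D.Y.X`, at every pinned polarisation and for every pinned-served class `w`,
`EllipticTensorWeilCarriers 𝒪 E₀` supplies the door datum `κ₃ = a·w + c₃·θ³`, `a ≠ 0`, sides on the `θ`-ray.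
[cite: Andre1996Motifs, Lemme 6.3.3 and proof (p. 33)] [cite: Bloch1972Semiregularity, Remark (7.5)] -/
theorem exists_datum_of_ellipticTensorWeilCarriers_of_chart {E₀ : AbelianVariety ℂ} (h : EllipticTensorWeilCarriers 𝒪 E₀)
    (D : SecantQuotientDatum) {X : SchemeOver ℂ} (e : X ≅ D.Y.X) (hJ : D.𝒥.J.IsIsogenous (E₀.powSucc 2))
    {θ : complexBetti X 2} {w : complexBetti X (2 * 3)} (hw : w ∈ secantQuotientServedClassesPinned X θ) :
    ∃ (I : Finset ℕ) (κ : (q : ℕ) → complexBetti X (2 * q)) (a : ℂ) (c : ℕ → ℂ),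
      3 ∈ I ∧ 𝒪 6 X I κ ∧ a ≠ 0 ∧ κ 3 = a • w + c 3 • cupPowTwo θ 3 ∧ ∀ q ∈ I, q ≠ 3 → κ q = c q • cupPowTwo θ q :=
  anchoredCarrierAt_secantQuotientPinned_ellipticPowerOf_of_ellipticTensorWeilCarriers h X θ
    ⟨secantQuotientAnchorsPinned_of_mem hw, D.Y, 5, D.dim_Y, D.isIsogenous_Y_powSucc_five hJ, ⟨e.symm⟩⟩ w hw hw.isRationalClass

/-- **Twisted door, every `C`: 2a″ at the `E³`-type anchors over `E₀` ⟸ `EllipticTensorWeilTwistedCarriers E₀`.**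
[cite: Andre1996Motifs, Lemme 6.3.3 and proof (p. 33)] [cite: Markman2025SecantWeil, §7.3 and Thm. 1.4.1] [cite: Bloch1972Semiregularity, Remark (7.5)] -/
theorem anchoredCarrierAt_tw_secantQuotientPinned_ellipticPowerOf_of_ellipticTensorWeilTwistedCarriers {E₀ : AbelianVariety ℂ}
    (h : EllipticTensorWeilTwistedCarriers E₀) (C : ChernCharacterBetti) :
    AnchoredCarrierAt (Literature.AlgebraicGeometry.HodgeTheory.twistedReflexiveClass C
        (fun n X₀ I E => Summit.Ventures.HSemireg.gluableSigmaAdmissible n X₀ I E ∨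
          Literature.AlgebraicGeometry.HodgeTheory.bfSingleAdmissible n X₀ I E)) 6 3
      (fun X θ ↦ secantQuotientAnchorsPinned X θ ∧
        ∃ (A₀ : AbelianVariety ℂ) (N : ℕ), A₀.dim = 6 ∧ A₀.IsIsogenous (E₀.powSucc N) ∧ Nonempty (A₀.X ≅ X))
      (fun X θ ↦ secantQuotientServedClassesPinned X θ) :=
  anchoredCarrierAt_secantQuotientPinned_ellipticPowerOf_of_ellipticTensorWeilCarriers (h C)

/-- **The cell's served half on the pencils through an `E³`-type anchor over `E₀`, from the Weil-carrier node.**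
[cite: Bloch1972Semiregularity, Remark (7.5)] [cite: vanGeemen1994HodgeAV, §2.4 and Thm. 4.11] -/
theorem under_hasServedFibre_secantQuotientPinned_ellipticPowerOf_of_ellipticTensorWeilCarriers {E₀ : AbelianVariety ℂ}
    (h : EllipticTensorWeilCarriers 𝒪 E₀) :
    LefAtExceptionalRegimeAtUnder 𝒪 6 3 (HasServedFibre 6 3
      (fun X θ ↦ secantQuotientAnchorsPinned X θ ∧
        ∃ (A₀ : AbelianVariety ℂ) (N : ℕ), A₀.dim = 6 ∧ A₀.IsIsogenous (E₀.powSucc N) ∧ Nonempty (A₀.X ≅ X))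
      (fun X θ ↦ secantQuotientServedClassesPinned X θ)) :=
  under_hasServedFibre_of_anchoredCarrierAt (anchoredCarrierAt_secantQuotientPinned_ellipticPowerOf_of_ellipticTensorWeilCarriers h)

/-- **Spreading from the Weil-carrier node**: door ∧ `EllipticTensorWeilCarriers 𝒪 E₀` ⟹ on every pencil of the crux's shape (smooth irreducible
affine curve base) through a pinned-served fibre that is a chart of a datum with `J ∼ E₀³`, `W` is algebraic on EVERY fibre.
[cite: BuchweitzFlenner2003, §5 Thm. 5.1] [cite: Markman2025SecantWeil, Thm. 1.5.1] [cite: Andre1996Motifs, Lemme 6.3.3 and proof (p. 33)] -/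
theorem mem_algebraicClasses_of_ellipticTensorWeilCarriers_servedFibre {E₀ : AbelianVariety ℂ} {𝒳 S : SchemeOver ℂ} {f : 𝒳 ⟶ S}
    (hT : LocalVariationalHodgeFor 𝒪) (h : EllipticTensorWeilCarriers 𝒪 E₀)
    (hf : IsSmoothProjectiveFamily f 6) (h𝒳 : IsQuasiProjectiveOver 𝒳) (hirr : IrreducibleSpace S.left) (haff : IsAffine S.left)
    (hsm : AlgebraicGeometry.Smooth S.hom) (hdim : topologicalKrullDim S.left = 1) (W : complexBetti 𝒳 (2 * 3))
    (hW : ∀ s : ComplexPoints S, IsRationalClass (complexBetti.map (fiberι f s) (2 * 3) W) ∧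
      IsOfHodgeType 6 (fiberOver f s) (2 * 3) 3 3 (complexBetti.map (fiberι f s) (2 * 3) W))
    (Θ : complexBetti 𝒳 2) (hΘQ : ∀ s : ComplexPoints S, IsRationalClass (complexBetti.map (fiberι f s) 2 Θ))
    (hΘH : ∀ s : ComplexPoints S, IsOfHodgeType 6 (fiberOver f s) 2 1 1 (complexBetti.map (fiberι f s) 2 Θ))
    (sₐ : ComplexPoints S) (D : SecantQuotientDatum) (e : fiberOver f sₐ ≅ D.Y.X) (hJ : D.𝒥.J.IsIsogenous (E₀.powSucc 2))
    (hserved : complexBetti.map (fiberι f sₐ) (2 * 3) W ∈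
      secantQuotientServedClassesPinned (fiberOver f sₐ) (complexBetti.map (fiberι f sₐ) 2 Θ))
    (s : ComplexPoints S) : complexBetti.map (fiberι f s) (2 * 3) W ∈ algebraicClasses (fiberOver f s) 3 :=
  mem_algebraicClasses_of_anchoredCarrierAt_of_hasServedFibre hT
    (anchoredCarrierAt_secantQuotientPinned_ellipticPowerOf_of_ellipticTensorWeilCarriers h) hf h𝒳 hirr haff hsm hdim W hW
    ⟨sₐ, Θ, hΘQ, hΘH, ⟨secantQuotientAnchorsPinned_of_mem hserved, D.Y, 5, D.dim_Y, D.isIsogenous_Y_powSucc_five hJ, ⟨e.symm⟩⟩, hserved⟩ s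

end WeilStructure

end Summit.HodgeConjecture.HodgeConjecture.Ring2.SemiregularRepresentatives

end
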